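import Summits.BirchSwinnertonDyer.Rank1Residual.P2.GenusSumsThreePrimes
import Summits.BirchSwinnertonDyer.Rank1Residual.P2.DecompositionsPrimeMul
import Summits.BirchSwinnertonDyer.Rank1Residual.P2.CongruentNumberPairsAtTwoEvenAtlasThreeCensus
import HarnessLib

/-!
# Sub-lane «bsd-p2»: TYZ's second genus sum `Σ₂ / Σ₂′` of a product of FOUR distinct primes in CLOSED
# FORM (fifteen decompositions; pattern bits `pat₂ / pat₃ / pat₄`) — the four-block reading the even
# `ω(m) = 3` atlas needs (`n = 2·p₀p₁p₂`)

HONEST FRAMING (sub-lane «bsd-p2», run/shared/lean/b2b/bsd-rank1-residual/p2/, verbatim in every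
file): the target of record is the FULL Birch–Swinnerton-Dyer formula for EVERY analytic-rank `≤ 1`
`E/ℚ` at ALL primes INCLUDING `2`; the odd-prime class ledger is referee A's; the `2`-part is OPEN
(cells O1 = X5 ∖ CM and O12 = the CM corner) and under census by «bsd-p2». Census / instrument
output at `2` = EVIDENCE / conjecture items with held-out validation, NEVER a Literature fact;
certificates close PAIRS (one isogeny class, `p = 2`), never classes. This file asserts NO
arithmetic fact: it is bookkeeping — TYZ's printed second genus sum of `n = q·a·b·c` written as a sum
of fourteen (for `Σ₂`) / fifteen (for `Σ₂′`, WITH the `ℓ = 0` term) explicit products of `g`-values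
weighted by the printed residue patterns, for ANY weight `g`.

WHAT IT DOES. monsky-lit's `GenusSumsThreePrimes.lean` (`natCast_genusSum₂'_three`) stops at three prime
factors; LEAD-OKS T-125 (2) recorded that «an even atlas at `n = 2pqr` needs a four-block genus-sum
reading the tree lacks». §1: the printed `Σ₂`-filter on a four-block decomposition `{w, x, y, z}` is the
pattern `pat₄` (the `Bool` reading lives with the other configuration readings in
`…EvenAtlasThreeCensus.lean`, so that this file declares no `def`), twin of `sigma2Filter_triple_iff`. §2: with the fifteen-term `sum_decompositions_four` (typer GEN 23,
`DecompositionsPrimeMul.lean`): `natCast_genusSum₂_four` and, for `qabc ≡ 5, 6, 7 (mod 8)`,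
`natCast_genusSum₂'_four` (lit-1's `genusSum₂'_eq_genusSum₂_add_self`). With `q = 2` these are the
readings of `Σ₂′(2p₀p₁p₂)` consumed by the even atlas; nothing of any `k = 4` cell is instantiated here.
Nothing booked; no mark moved. Unit `b2b-bsdres-p2-typer` GEN 23; scratch (NOT proposed — rails
T-149 (e) / T-155 (o)).

References: [TianYuanZhang2017] Thm 1.2 (the second genus sum: `d₀ ≡ 5, 6, 7`, `d₁ ≡ 1, 2, 3`,
`dᵢ ≡ 1 (mod 8)` for `i > 1`), proof of Prop. 3.4 (p0016 L146: the `ℓ = 0` term); [HardyWright2008]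
§1.3 Thm 2.
-/

open Finset Literature.NumberTheory.EllipticCurves.TianYuanZhang2017

set_option autoImplicit false

namespace Summit.BirchSwinnertonDyer.Rank1Residual.P2

/-! ## §1 The printed `Σ₂`-filter on four blocks -/

section Filter

/-- **TYZ's `Σ₂`-filter on the four-block decomposition `{w, x, y, z}` is the pattern `pat₄ w x y z`.**
[cite: TianYuanZhang2017, Thm. 1.2 (Σ₂: d₀ ≡ 5,6,7, d₁ ≡ 1,2,3, dᵢ ≡ 1 (mod 8) for i > 1)] -/
theorem sigma2Filter_quad_iff {w x y z : ℕ} (hwx : w ≠ x) (hwy : w ≠ y) (hwz : w ≠ z) (hxy : x ≠ y)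
    (hxz : x ≠ z) (hyz : y ≠ z) :
    (∃ d₀ ∈ ({w, x, y, z} : Finset ℕ), ∃ d₁ ∈ ({w, x, y, z} : Finset ℕ), d₀ ≠ d₁ ∧
      (d₀ % 8 = 5 ∨ d₀ % 8 = 6 ∨ d₀ % 8 = 7) ∧ (d₁ % 8 = 1 ∨ d₁ % 8 = 2 ∨ d₁ % 8 = 3) ∧
      ∀ d ∈ ({w, x, y, z} : Finset ℕ), d ≠ d₀ → d ≠ d₁ → d % 8 = 1) ↔ pat₄ w x y z = true := by
  rw [pat₄_iff]
  simp only [pat₂_iff]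
  have mw : w ∈ ({w, x, y, z} : Finset ℕ) := by simp
  have mx : x ∈ ({w, x, y, z} : Finset ℕ) := by simp
  have my : y ∈ ({w, x, y, z} : Finset ℕ) := by simp
  have mz : z ∈ ({w, x, y, z} : Finset ℕ) := by simp
  have mem4 : ∀ d ∈ ({w, x, y, z} : Finset ℕ), d = w ∨ d = x ∨ d = y ∨ d = z := fun d hd => by
    simpa only [Finset.mem_insert, Finset.mem_singleton] using hd
  constructor
  · rintro ⟨d₀, hd₀, d₁, hd₁, hne, h0, h1, hrest⟩
    rcases mem4 d₀ hd₀ with rfl | rfl | rfl | rfl <;> rcases mem4 d₁ hd₁ with rfl | rfl | rfl | rfl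
    · exact absurd rfl hne
    · exact Or.inl ⟨Or.inl ⟨h0, h1⟩, hrest y my hwy.symm hxy.symm, hrest z mz hwz.symm hxz.symm⟩
    · exact Or.inr (Or.inl ⟨Or.inl ⟨h0, h1⟩, hrest x mx hwx.symm hxy, hrest z mz hwz.symm hyz.symm⟩)
    · exact Or.inr (Or.inr (Or.inl ⟨Or.inl ⟨h0, h1⟩, hrest x mx hwx.symm hxz, hrest y my hwy.symm hyz⟩))
    · exact Or.inl ⟨Or.inr ⟨h0, h1⟩, hrest y my hxy.symm hwy.symm, hrest z mz hxz.symm hwz.symm⟩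
    · exact absurd rfl hne
    · exact Or.inr (Or.inr (Or.inr (Or.inl ⟨Or.inl ⟨h0, h1⟩, hrest w mw hwx hwy, hrest z mz hxz.symm hyz.symm⟩)))
    · exact Or.inr (Or.inr (Or.inr (Or.inr (Or.inl ⟨Or.inl ⟨h0, h1⟩, hrest w mw hwx hwz, hrest y my hxy.symm hyz⟩))))
    · exact Or.inr (Or.inl ⟨Or.inr ⟨h0, h1⟩, hrest x mx hxy hwx.symm, hrest z mz hyz.symm hwz.symm⟩)
    · exact Or.inr (Or.inr (Or.inr (Or.inl ⟨Or.inr ⟨h0, h1⟩, hrest w mw hwy hwx, hrest z mz hyz.symm hxz.symm⟩)))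
    · exact absurd rfl hne
    · exact Or.inr (Or.inr (Or.inr (Or.inr (Or.inr ⟨Or.inl ⟨h0, h1⟩, hrest w mw hwy hwz, hrest x mx hxy hxz⟩))))
    · exact Or.inr (Or.inr (Or.inl ⟨Or.inr ⟨h0, h1⟩, hrest x mx hxz hwx.symm, hrest y my hyz hwy.symm⟩))
    · exact Or.inr (Or.inr (Or.inr (Or.inr (Or.inl ⟨Or.inr ⟨h0, h1⟩, hrest w mw hwz hwx, hrest y my hyz hxy.symm⟩))))
    · exact Or.inr (Or.inr (Or.inr (Or.inr (Or.inr ⟨Or.inr ⟨h0, h1⟩, hrest w mw hwz hwy, hrest x mx hxz hxy⟩))))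
    · exact absurd rfl hne
  · -- each of the six pairs, in either orientation, gives the witnesses
    have build : ∀ u v : ℕ, u ∈ ({w, x, y, z} : Finset ℕ) → v ∈ ({w, x, y, z} : Finset ℕ) → u ≠ v →
        (u % 8 = 5 ∨ u % 8 = 6 ∨ u % 8 = 7) → (v % 8 = 1 ∨ v % 8 = 2 ∨ v % 8 = 3) →
        (∀ d ∈ ({w, x, y, z} : Finset ℕ), d ≠ u → d ≠ v → d % 8 = 1) →
        ∃ d₀ ∈ ({w, x, y, z} : Finset ℕ), ∃ d₁ ∈ ({w, x, y, z} : Finset ℕ), d₀ ≠ d₁ ∧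
          (d₀ % 8 = 5 ∨ d₀ % 8 = 6 ∨ d₀ % 8 = 7) ∧ (d₁ % 8 = 1 ∨ d₁ % 8 = 2 ∨ d₁ % 8 = 3) ∧
          ∀ d ∈ ({w, x, y, z} : Finset ℕ), d ≠ d₀ → d ≠ d₁ → d % 8 = 1 :=
      fun u v hu hv huv h0 h1 hrest => ⟨u, hu, v, hv, huv, h0, h1, hrest⟩
    have rest : ∀ u v s t : ℕ, (∀ d ∈ ({w, x, y, z} : Finset ℕ), d = u ∨ d = v ∨ d = s ∨ d = t) →
        s % 8 = 1 → t % 8 = 1 → ∀ d ∈ ({w, x, y, z} : Finset ℕ), d ≠ u → d ≠ v → d % 8 = 1 := by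
      intro u v s t hmem hs ht d hd hdu hdv
      rcases hmem d hd with rfl | rfl | rfl | rfl
      · exact absurd rfl hdu
      · exact absurd rfl hdv
      · exact hs
      · exact ht
    have pwx : ∀ d ∈ ({w, x, y, z} : Finset ℕ), d = w ∨ d = x ∨ d = y ∨ d = z := mem4
    have pwy : ∀ d ∈ ({w, x, y, z} : Finset ℕ), d = w ∨ d = y ∨ d = x ∨ d = z := fun d hd => by
      rcases mem4 d hd with h | h | h | h <;> simp [h]
    have pwz : ∀ d ∈ ({w, x, y, z} : Finset ℕ), d = w ∨ d = z ∨ d = x ∨ d = y := fun d hd => by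
      rcases mem4 d hd with h | h | h | h <;> simp [h]
    have pxy : ∀ d ∈ ({w, x, y, z} : Finset ℕ), d = x ∨ d = y ∨ d = w ∨ d = z := fun d hd => by
      rcases mem4 d hd with h | h | h | h <;> simp [h]
    have pxz : ∀ d ∈ ({w, x, y, z} : Finset ℕ), d = x ∨ d = z ∨ d = w ∨ d = y := fun d hd => by
      rcases mem4 d hd with h | h | h | h <;> simp [h]
    have pyz : ∀ d ∈ ({w, x, y, z} : Finset ℕ), d = y ∨ d = z ∨ d = w ∨ d = x := fun d hd => by
      rcases mem4 d hd with h | h | h | h <;> simp [h]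
    have swap : ∀ u v s t : ℕ, (∀ d ∈ ({w, x, y, z} : Finset ℕ), d = u ∨ d = v ∨ d = s ∨ d = t) →
        ∀ d ∈ ({w, x, y, z} : Finset ℕ), d = v ∨ d = u ∨ d = s ∨ d = t := by
      intro u v s t h d hd
      rcases h d hd with h | h | h | h
      exacts [Or.inr (Or.inl h), Or.inl h, Or.inr (Or.inr (Or.inl h)), Or.inr (Or.inr (Or.inr h))]
    rintro ((⟨⟨h0, h1⟩ | ⟨h0, h1⟩, hs, ht⟩) | (⟨⟨h0, h1⟩ | ⟨h0, h1⟩, hs, ht⟩) |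
      (⟨⟨h0, h1⟩ | ⟨h0, h1⟩, hs, ht⟩) | (⟨⟨h0, h1⟩ | ⟨h0, h1⟩, hs, ht⟩) |
      (⟨⟨h0, h1⟩ | ⟨h0, h1⟩, hs, ht⟩) | (⟨⟨h0, h1⟩ | ⟨h0, h1⟩, hs, ht⟩))
    · exact build w x mw mx hwx h0 h1 (rest w x y z pwx hs ht)
    · exact build x w mx mw hwx.symm h0 h1 (rest x w y z (swap w x y z pwx) hs ht)
    · exact build w y mw my hwy h0 h1 (rest w y x z pwy hs ht)
    · exact build y w my mw hwy.symm h0 h1 (rest y w x z (swap w y x z pwy) hs ht)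
    · exact build w z mw mz hwz h0 h1 (rest w z x y pwz hs ht)
    · exact build z w mz mw hwz.symm h0 h1 (rest z w x y (swap w z x y pwz) hs ht)
    · exact build x y mx my hxy h0 h1 (rest x y w z pxy hs ht)
    · exact build y x my mx hxy.symm h0 h1 (rest y x w z (swap x y w z pxy) hs ht)
    · exact build x z mx mz hxz h0 h1 (rest x z w y pxz hs ht)
    · exact build z x mz mx hxz.symm h0 h1 (rest z x w y (swap x z w y pxz) hs ht)
    · exact build y z my mz hyz h0 h1 (rest y z w x pyz hs ht)
    · exact build z y mz my hyz.symm h0 h1 (rest z y w x (swap y z w x pyz) hs ht)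

end Filter

/-! ## §2 `Σ₂` and `Σ₂′` of four distinct primes in closed form -/

section GenusSums

variable {q a b c : ℕ}

/-- A prime differs from any multiple of another prime. [cite: HardyWright2008, §1.3 Thm. 2] -/
theorem prime_ne_of_prime_dvd {q a m : ℕ} (hq : q.Prime) (ha : a.Prime) (hqa : q ≠ a) (ham : a ∣ m) :
    q ≠ m := fun h => hqa ((Nat.prime_dvd_prime_iff_eq ha hq).mp (h ▸ ham)).symm

/-- Two numbers differ if some prime divides one and not the other. [cite: HardyWright2008, §1.3 Thm. 2] -/
theorem ne_of_dvd_of_not_dvd {p u v : ℕ} (hv : p ∣ v) (hu : ¬ p ∣ u) : u ≠ v :=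
  fun h => hu (h ▸ hv)

/-- **`Σ₂(qabc) mod 2` in closed form** (four distinct primes, any weight `g`): the one-block
decomposition does not occur (two distinct blocks are required); the seven two-block terms carry
`pat₂`, the six three-block terms `pat₃`, the four-block term `pat₄`.
[cite: TianYuanZhang2017, Thm. 1.2 (the second sum)] -/
theorem natCast_genusSum₂_four (g : ℕ → ℕ) (hq : q.Prime) (ha : a.Prime) (hb : b.Prime)
    (hc : c.Prime) (hqa : q ≠ a) (hqb : q ≠ b) (hqc : q ≠ c) (hab : a ≠ b) (hac : a ≠ c)
    (hbc : b ≠ c) :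
    ((genusSum₂ (q * a * b * c) g : ℕ) : ZMod 2) =
      bitOf (pat₂ q (a * b * c) = true) * ((g q : ZMod 2) * (g (a * b * c) : ZMod 2))
      + bitOf (pat₂ (q * a) (b * c) = true) * ((g (q * a) : ZMod 2) * (g (b * c) : ZMod 2))
      + bitOf (pat₂ (q * b) (a * c) = true) * ((g (q * b) : ZMod 2) * (g (a * c) : ZMod 2))
      + bitOf (pat₂ (q * c) (a * b) = true) * ((g (q * c) : ZMod 2) * (g (a * b) : ZMod 2))
      + bitOf (pat₂ (q * b * c) a = true) * ((g (q * b * c) : ZMod 2) * (g a : ZMod 2))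
      + bitOf (pat₂ (q * a * c) b = true) * ((g (q * a * c) : ZMod 2) * (g b : ZMod 2))
      + bitOf (pat₂ (q * a * b) c = true) * ((g (q * a * b) : ZMod 2) * (g c : ZMod 2))
      + bitOf (pat₃ q a (b * c) = true) * ((g q : ZMod 2) * (g a : ZMod 2) * (g (b * c) : ZMod 2))
      + bitOf (pat₃ q b (a * c) = true) * ((g q : ZMod 2) * (g b : ZMod 2) * (g (a * c) : ZMod 2))
      + bitOf (pat₃ q c (a * b) = true) * ((g q : ZMod 2) * (g c : ZMod 2) * (g (a * b) : ZMod 2))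
      + bitOf (pat₃ (q * a) b c = true) * ((g (q * a) : ZMod 2) * (g b : ZMod 2) * (g c : ZMod 2))
      + bitOf (pat₃ (q * b) a c = true) * ((g (q * b) : ZMod 2) * (g a : ZMod 2) * (g c : ZMod 2))
      + bitOf (pat₃ (q * c) a b = true) * ((g (q * c) : ZMod 2) * (g a : ZMod 2) * (g b : ZMod 2))
      + bitOf (pat₄ q a b c = true) *
          ((g q : ZMod 2) * (g a : ZMod 2) * (g b : ZMod 2) * (g c : ZMod 2)) := by
  -- nineteen inequalities between blocks
  have nq_abc : q ≠ a * b * c := prime_ne_of_prime_dvd hq hc hqc (dvd_mul_left c (a * b))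
  have nq_bc : q ≠ b * c := prime_ne_of_prime_dvd hq hb hqb (dvd_mul_right b c)
  have nq_ac : q ≠ a * c := prime_ne_of_prime_dvd hq ha hqa (dvd_mul_right a c)
  have nq_ab : q ≠ a * b := prime_ne_of_prime_dvd hq ha hqa (dvd_mul_right a b)
  have na_bc : a ≠ b * c := prime_ne_of_prime_dvd ha hb hab (dvd_mul_right b c)
  have nb_ac : b ≠ a * c := prime_ne_of_prime_dvd hb ha hab.symm (dvd_mul_right a c)
  have nc_ab : c ≠ a * b := prime_ne_of_prime_dvd hc ha hac.symm (dvd_mul_right a b)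
  have na_qbc : a ≠ q * b * c := prime_ne_of_prime_dvd ha hq hqa.symm ((dvd_mul_right q b).mul_right c)
  have nb_qac : b ≠ q * a * c := prime_ne_of_prime_dvd hb hq hqb.symm ((dvd_mul_right q a).mul_right c)
  have nc_qab : c ≠ q * a * b := prime_ne_of_prime_dvd hc hq hqc.symm ((dvd_mul_right q a).mul_right b)
  have nb_qa : b ≠ q * a := prime_ne_of_prime_dvd hb hq hqb.symm (dvd_mul_right q a)
  have nc_qa : c ≠ q * a := prime_ne_of_prime_dvd hc hq hqc.symm (dvd_mul_right q a)
  have na_qb : a ≠ q * b := prime_ne_of_prime_dvd ha hq hqa.symm (dvd_mul_right q b)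
  have nc_qb : c ≠ q * b := prime_ne_of_prime_dvd hc hq hqc.symm (dvd_mul_right q b)
  have na_qc : a ≠ q * c := prime_ne_of_prime_dvd ha hq hqa.symm (dvd_mul_right q c)
  have nb_qc : b ≠ q * c := prime_ne_of_prime_dvd hb hq hqb.symm (dvd_mul_right q c)
  have nqa_bc : q * a ≠ b * c :=
    ne_of_dvd_of_not_dvd (dvd_mul_right b c) (not_dvd_mul_of_prime_ne hb hq ha hqb.symm hab.symm)
  have nqb_ac : q * b ≠ a * c :=
    ne_of_dvd_of_not_dvd (dvd_mul_right a c) (not_dvd_mul_of_prime_ne ha hq hb hqa.symm hab)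
  have nqc_ab : q * c ≠ a * b :=
    ne_of_dvd_of_not_dvd (dvd_mul_right a b) (not_dvd_mul_of_prime_ne ha hq hc hqa.symm hac)
  unfold genusSum₂
  rw [Finset.sum_filter, Nat.cast_sum, sum_decompositions_four hq ha hb hc hqa hqb hqc hab hac hbc]
  -- the one-block term vanishes: no two distinct blocks
  have t1 : ¬ (∃ d₀ ∈ ({q * a * b * c} : Finset ℕ), ∃ d₁ ∈ ({q * a * b * c} : Finset ℕ), d₀ ≠ d₁ ∧
      (d₀ % 8 = 5 ∨ d₀ % 8 = 6 ∨ d₀ % 8 = 7) ∧ (d₁ % 8 = 1 ∨ d₁ % 8 = 2 ∨ d₁ % 8 = 3) ∧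
      ∀ d ∈ ({q * a * b * c} : Finset ℕ), d ≠ d₀ → d ≠ d₁ → d % 8 = 1) := by
    rintro ⟨d₀, hd₀, d₁, hd₁, hne, -⟩
    rw [Finset.mem_singleton] at hd₀ hd₁
    exact hne (hd₀.trans hd₁.symm)
  rw [if_neg t1]
  simp only [Nat.cast_ite, Nat.cast_mul, Nat.cast_zero, ite_eq_bitOf_mul,
    bitOf_congr (sigma2Filter_pair_iff nq_abc), bitOf_congr (sigma2Filter_pair_iff nqa_bc),
    bitOf_congr (sigma2Filter_pair_iff nqb_ac), bitOf_congr (sigma2Filter_pair_iff nqc_ab),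
    bitOf_congr (sigma2Filter_pair_iff na_qbc.symm), bitOf_congr (sigma2Filter_pair_iff nb_qac.symm),
    bitOf_congr (sigma2Filter_pair_iff nc_qab.symm),
    bitOf_congr (sigma2Filter_triple_iff hqa nq_bc na_bc),
    bitOf_congr (sigma2Filter_triple_iff hqb nq_ac nb_ac),
    bitOf_congr (sigma2Filter_triple_iff hqc nq_ab nc_ab),
    bitOf_congr (sigma2Filter_triple_iff nb_qa.symm nc_qa.symm hbc),
    bitOf_congr (sigma2Filter_triple_iff na_qb.symm nc_qb.symm hac),
    bitOf_congr (sigma2Filter_triple_iff na_qc.symm nb_qc.symm hab),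
    bitOf_congr (sigma2Filter_quad_iff hqa hqb hqc hab hac hbc),
    Finset.prod_insert (show q ∉ ({a * b * c} : Finset ℕ) by simpa using nq_abc),
    Finset.prod_insert (show q * a ∉ ({b * c} : Finset ℕ) by simpa using nqa_bc),
    Finset.prod_insert (show q * b ∉ ({a * c} : Finset ℕ) by simpa using nqb_ac),
    Finset.prod_insert (show q * c ∉ ({a * b} : Finset ℕ) by simpa using nqc_ab),
    Finset.prod_insert (show q * b * c ∉ ({a} : Finset ℕ) by simpa using na_qbc.symm),
    Finset.prod_insert (show q * a * c ∉ ({b} : Finset ℕ) by simpa using nb_qac.symm),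
    Finset.prod_insert (show q * a * b ∉ ({c} : Finset ℕ) by simpa using nc_qab.symm),
    Finset.prod_insert (show q ∉ ({a, b * c} : Finset ℕ) by simp [hqa, nq_bc]),
    Finset.prod_insert (show q ∉ ({b, a * c} : Finset ℕ) by simp [hqb, nq_ac]),
    Finset.prod_insert (show q ∉ ({c, a * b} : Finset ℕ) by simp [hqc, nq_ab]),
    Finset.prod_insert (show a ∉ ({b * c} : Finset ℕ) by simpa using na_bc),
    Finset.prod_insert (show b ∉ ({a * c} : Finset ℕ) by simpa using nb_ac),
    Finset.prod_insert (show c ∉ ({a * b} : Finset ℕ) by simpa using nc_ab),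
    Finset.prod_insert (show q * a ∉ ({b, c} : Finset ℕ) by simp [nb_qa.symm, nc_qa.symm]),
    Finset.prod_insert (show q * b ∉ ({a, c} : Finset ℕ) by simp [na_qb.symm, nc_qb.symm]),
    Finset.prod_insert (show q * c ∉ ({a, b} : Finset ℕ) by simp [na_qc.symm, nb_qc.symm]),
    Finset.prod_insert (show q ∉ ({a, b, c} : Finset ℕ) by simp [hqa, hqb, hqc]),
    Finset.prod_insert (show a ∉ ({b, c} : Finset ℕ) by simp [hab, hac]),
    Finset.prod_insert (show b ∉ ({c} : Finset ℕ) by simpa using hbc),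
    Finset.prod_insert (show a ∉ ({c} : Finset ℕ) by simpa using hac),
    Finset.prod_insert (show a ∉ ({b} : Finset ℕ) by simpa using hab), Finset.prod_singleton]
  ring

/-- **`Σ₂′(qabc) mod 2` in closed form** (four distinct primes, any weight `g`) — TYZ's second sum AS
PRINTED (`genusSum₂'`, WITH the `ℓ = 0` term `{qabc}`; ERRATUM F-Σ2): for `qabc ≡ 5, 6, 7 (mod 8)` it is
`g(qabc)` plus the `Σ₂` form of `natCast_genusSum₂_four`. With `q = 2`: `Σ₂′(2p₀p₁p₂)`, `n ≡ 6 (mod 8)`.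
[cite: TianYuanZhang2017, Thm. 1.2 (the second sum) and proof of Prop. 3.4 (p0016 L146)] -/
theorem natCast_genusSum₂'_four (g : ℕ → ℕ) (hq : q.Prime) (ha : a.Prime) (hb : b.Prime)
    (hc : c.Prime) (hqa : q ≠ a) (hqb : q ≠ b) (hqc : q ≠ c) (hab : a ≠ b) (hac : a ≠ c)
    (hbc : b ≠ c)
    (h8 : (q * a * b * c) % 8 = 5 ∨ (q * a * b * c) % 8 = 6 ∨ (q * a * b * c) % 8 = 7) :
    ((genusSum₂' (q * a * b * c) g : ℕ) : ZMod 2) =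
      (g (q * a * b * c) : ZMod 2)
      + bitOf (pat₂ q (a * b * c) = true) * ((g q : ZMod 2) * (g (a * b * c) : ZMod 2))
      + bitOf (pat₂ (q * a) (b * c) = true) * ((g (q * a) : ZMod 2) * (g (b * c) : ZMod 2))
      + bitOf (pat₂ (q * b) (a * c) = true) * ((g (q * b) : ZMod 2) * (g (a * c) : ZMod 2))
      + bitOf (pat₂ (q * c) (a * b) = true) * ((g (q * c) : ZMod 2) * (g (a * b) : ZMod 2))
      + bitOf (pat₂ (q * b * c) a = true) * ((g (q * b * c) : ZMod 2) * (g a : ZMod 2))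
      + bitOf (pat₂ (q * a * c) b = true) * ((g (q * a * c) : ZMod 2) * (g b : ZMod 2))
      + bitOf (pat₂ (q * a * b) c = true) * ((g (q * a * b) : ZMod 2) * (g c : ZMod 2))
      + bitOf (pat₃ q a (b * c) = true) * ((g q : ZMod 2) * (g a : ZMod 2) * (g (b * c) : ZMod 2))
      + bitOf (pat₃ q b (a * c) = true) * ((g q : ZMod 2) * (g b : ZMod 2) * (g (a * c) : ZMod 2))
      + bitOf (pat₃ q c (a * b) = true) * ((g q : ZMod 2) * (g c : ZMod 2) * (g (a * b) : ZMod 2))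
      + bitOf (pat₃ (q * a) b c = true) * ((g (q * a) : ZMod 2) * (g b : ZMod 2) * (g c : ZMod 2))
      + bitOf (pat₃ (q * b) a c = true) * ((g (q * b) : ZMod 2) * (g a : ZMod 2) * (g c : ZMod 2))
      + bitOf (pat₃ (q * c) a b = true) * ((g (q * c) : ZMod 2) * (g a : ZMod 2) * (g b : ZMod 2))
      + bitOf (pat₄ q a b c = true) *
          ((g q : ZMod 2) * (g a : ZMod 2) * (g b : ZMod 2) * (g c : ZMod 2)) := by
  have h1 : 1 < q * a * b * c :=
    hq.one_lt.trans_le (((Nat.le_mul_of_pos_right q ha.pos).trans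
      (Nat.le_mul_of_pos_right _ hb.pos)).trans (Nat.le_mul_of_pos_right _ hc.pos))
  rw [genusSum₂'_eq_genusSum₂_add_self h1 h8, Nat.cast_add,
    natCast_genusSum₂_four g hq ha hb hc hqa hqb hqc hab hac hbc]
  ring

end GenusSums

end Summit.BirchSwinnertonDyer.Rank1Residual.P2
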